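import Literature.Probability.Percolation.ArmSeparationThinRing
import Literature.Probability.Percolation.ArmSeparationSectors
import HarnessLib

/-!
# Indexing the thin ring: sides, lateral indices, windows and their complements

Topic: Probability / Percolation; family `crit-perc`. A toolkit brick of the discharge of
`Literature.Probability.Percolation.Nolin2008_twoArm_separation` (Nolin 2008, Thm. 11
[arXiv 0711.4948: Thm. 10]; `ArmSeparation.lean`), landing step of the internal extremities
(Nolin 2008, Prop. 12 [arXiv Prop. 11]). The `g`-th tube of the thin ring `thinRing r e s`
(`ArmSeparationThinRing.lean`, `n = r/s` chunks per side, `12n - 4` tubes) is made explicit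
(`ringTube`, `getElem?_thinRing`), together with its **side** `ringSide g < 6` and **lateral
index** `ringLat g < n`: every site `v` of the tube lies in the sector `sectorNear (ringSide g) (-2e)`
(`ArmSeparationSectors.lean`) with lateral coordinate
`lat (ringSide g) v ∈ [-r + ι s - e, -r + (ι+1) s + e]`, `ι = ringLat g` (`ringTube_bounds`).
A **window** is a contiguous range of indices `[lo, hi]`; its complement is the arc
`arc L (hi+1) (|L| - (hi - lo + 1))`, whose tubes are exactly the tubes of index outside the window
(`mem_arc_compl`, `getElem_mem_arc_compl`). The corridor of one colour is such a complement,
the window being the few tubes that the other colour's structures may touch.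

## References

* P. Nolin, *Near-critical percolation in two dimensions*, Electron. J. Probab. 13 (2008), §4.3
  Prop. 12, §4.4 [arXiv 0711.4948: Prop. 11, Thm. 10]. [Nolin2008]
-/

noncomputable section

open Set

namespace Literature.Probability.Percolation

open LatticeModels Tube

/-! ### Odd positions of the chunked sides and of the staircase -/

section Odd

variable (x y₀ : ℤ) (e s : ℕ)

/-- Odd positions of the chunked vertical side are the connectors. [folklore] -/
theorem getElem?_vchunks_odd : ∀ (j d i : ℕ), i + 1 < d → (vchunks x y₀ e s j d)[2 * i + 1]? = some (vConn x y₀ e s (j + i))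
  | _, 0, _, h => by omega
  | _, 1, _, h => by omega
  | j, d + 2, 0, _ => rfl
  | j, d + 2, i + 1, h => by
    rw [vchunks, show 2 * (i + 1) + 1 = 2 * i + 1 + 1 + 1 by ring, List.getElem?_cons_succ, List.getElem?_cons_succ,
      getElem?_vchunks_odd (j + 1) (d + 1) i (by omega), Nat.add_right_comm, Nat.add_assoc]

/-- Odd positions of the chunked horizontal side are the connectors. [folklore] -/
theorem getElem?_hchunks_odd : ∀ (j d i : ℕ), i + 1 < d → (hchunks x y₀ e s j d)[2 * i + 1]? = some (hConn x y₀ e s (j + i))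
  | _, 0, _, h => by omega
  | _, 1, _, h => by omega
  | j, d + 2, 0, _ => rfl
  | j, d + 2, i + 1, h => by
    rw [hchunks, show 2 * (i + 1) + 1 = 2 * i + 1 + 1 + 1 by ring, List.getElem?_cons_succ, List.getElem?_cons_succ,
      getElem?_hchunks_odd (j + 1) (d + 1) i (by omega), Nat.add_right_comm, Nat.add_assoc]

end Odd

/-- Odd positions of the staircase are the vertical steps. [folklore] -/
theorem getElem?_stair_odd (r e s : ℕ) : ∀ (j d i : ℕ), i < d → (stair r e s j d)[2 * i + 1]? = some (stairV r e s (j + i))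
  | _, 0, _, h => by omega
  | j, d + 1, 0, _ => rfl
  | j, d + 1, i + 1, h => by
    rw [stair, show 2 * (i + 1) + 1 = 2 * i + 1 + 1 + 1 by ring, List.getElem?_cons_succ, List.getElem?_cons_succ,
      getElem?_stair_odd r e s (j + 1) d i (by omega), Nat.add_right_comm, Nat.add_assoc]

/-! ### The `g`-th tube of the thin ring -/

/-- The `ℓ`-th tube of the thin half ring (`n = r / s`): positions `< 2n - 1` are the chunked side
`x₀ = r`, the next `2n` the staircase, the last `2n - 1` the chunked side `x₁ = r`. [folklore] -/
def halfTube (r e s ℓ : ℕ) : Tube :=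
  if ℓ < 2 * (r / s) - 1 then (if ℓ % 2 = 0 then vPiece r (-(r : ℤ)) e s (ℓ / 2) else vConn r (-(r : ℤ)) e s (ℓ / 2))
  else if ℓ < 4 * (r / s) - 1 then
    (if (ℓ - (2 * (r / s) - 1)) % 2 = 0 then stairH r e s ((ℓ - (2 * (r / s) - 1)) / 2)
      else stairV r e s ((ℓ - (2 * (r / s) - 1)) / 2))
  else (if (ℓ - (4 * (r / s) - 1)) % 2 = 0 then hPiece 0 r e s ((ℓ - (4 * (r / s) - 1)) / 2)
    else hConn 0 r e s ((ℓ - (4 * (r / s) - 1)) / 2))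

/-- **The `g`-th tube of the thin ring**: the half ring, then its reflection. [folklore] -/
def ringTube (r e s g : ℕ) : Tube :=
  if g < 6 * (r / s) - 2 then halfTube r e s g else (halfTube r e s (g - (6 * (r / s) - 2))).neg

/-- **The side of the `g`-th tube** (`0, 1, 2` on the half ring, `3, 4, 5` on its reflection). [folklore] -/
def ringSide (r s g : ℕ) : ℕ :=
  if g < 6 * (r / s) - 2 then (if g < 2 * (r / s) - 1 then 0 else if g < 4 * (r / s) - 1 then 1 else 2)
  else (if g - (6 * (r / s) - 2) < 2 * (r / s) - 1 then 3 else if g - (6 * (r / s) - 2) < 4 * (r / s) - 1 then 4 else 5)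

/-- **The lateral index of the `g`-th tube**: the tube's lateral coordinate in the frame of its side
lies in `[-r + ι s - e, -r + (ι + 1) s + e]`. [folklore] -/
def ringLat (r s g : ℕ) : ℕ :=
  if g < 6 * (r / s) - 2 then
    (if g < 2 * (r / s) - 1 then g / 2 else if g < 4 * (r / s) - 1 then (g - (2 * (r / s) - 1)) / 2
      else r / s - 1 - (g - (4 * (r / s) - 1)) / 2)
  else
    (if g - (6 * (r / s) - 2) < 2 * (r / s) - 1 then (g - (6 * (r / s) - 2)) / 2
      else if g - (6 * (r / s) - 2) < 4 * (r / s) - 1 then (g - (6 * (r / s) - 2) - (2 * (r / s) - 1)) / 2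
      else r / s - 1 - (g - (6 * (r / s) - 2) - (4 * (r / s) - 1)) / 2)

/-- The half ring, tube by tube (`1 ≤ r / s`, `ℓ < 6n - 2`). [folklore] -/
theorem getElem?_thinHalfRing {r e s : ℕ} (hr : 1 ≤ r / s) {ℓ : ℕ} (hℓ : ℓ < 6 * (r / s) - 2) :
    (thinHalfRing r e s)[ℓ]? = some (halfTube r e s ℓ) := by
  obtain ⟨d, hd⟩ : ∃ d, r / s = d + 1 := ⟨r / s - 1, by omega⟩
  have hA : (vchunks (r : ℤ) (-(r : ℤ)) e s 0 (r / s)).length = 2 * d + 1 := by rw [hd, length_vchunks]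
  have hB : (stair r e s 0 (r / s)).length = 2 * (d + 1) := by rw [hd, length_stair]
  unfold thinHalfRing halfTube
  by_cases h1 : ℓ < 2 * (r / s) - 1
  · rw [if_pos h1, List.getElem?_append_left (by rw [List.length_append, hA, hB]; omega),
      List.getElem?_append_left (by rw [hA]; omega)]
    rcases Nat.even_or_odd ℓ with ⟨i, rfl⟩ | ⟨i, rfl⟩
    · rw [if_pos (by omega), show i + i = 2 * i by ring, hd, getElem?_vchunks_even _ _ e s 0 (d + 1) i (by omega), Nat.zero_add,
        show 2 * i / 2 = i by omega]
    · rw [if_neg (by omega), hd, getElem?_vchunks_odd _ _ e s 0 (d + 1) i (by omega), Nat.zero_add,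
        show (2 * i + 1) / 2 = i by omega]
  · rw [if_neg h1]
    by_cases h2 : ℓ < 4 * (r / s) - 1
    · rw [if_pos h2, List.getElem?_append_left (by rw [List.length_append, hA, hB]; omega),
        List.getElem?_append_right (by rw [hA]; omega), hA]
      obtain ⟨ℓ', rfl⟩ : ∃ ℓ', ℓ = ℓ' + (2 * d + 1) := ⟨ℓ - (2 * d + 1), by omega⟩
      rw [Nat.add_sub_cancel, show ℓ' + (2 * d + 1) - (2 * (r / s) - 1) = ℓ' by omega]
      rcases Nat.even_or_odd ℓ' with ⟨i, rfl⟩ | ⟨i, rfl⟩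
      · rw [if_pos (by omega), show i + i = 2 * i by ring, hd, getElem?_stair_even r e s 0 (d + 1) i (by omega), Nat.zero_add,
          show 2 * i / 2 = i by omega]
      · rw [if_neg (by omega), hd, getElem?_stair_odd r e s 0 (d + 1) i (by omega), Nat.zero_add,
          show (2 * i + 1) / 2 = i by omega]
    · rw [if_neg h2, List.getElem?_append_right (by rw [List.length_append, hA, hB]; omega), List.length_append, hA, hB]
      obtain ⟨ℓ', rfl⟩ : ∃ ℓ', ℓ = ℓ' + (2 * d + 1 + 2 * (d + 1)) := ⟨ℓ - (2 * d + 1 + 2 * (d + 1)), by omega⟩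
      rw [Nat.add_sub_cancel, show ℓ' + (2 * d + 1 + 2 * (d + 1)) - (4 * (r / s) - 1) = ℓ' by omega]
      rcases Nat.even_or_odd ℓ' with ⟨i, rfl⟩ | ⟨i, rfl⟩
      · rw [if_pos (by omega), show i + i = 2 * i by ring, hd, getElem?_hchunks_even _ _ e s 0 (d + 1) i (by omega), Nat.zero_add,
          show 2 * i / 2 = i by omega]
      · rw [if_neg (by omega), hd, getElem?_hchunks_odd _ _ e s 0 (d + 1) i (by omega), Nat.zero_add,
          show (2 * i + 1) / 2 = i by omega]

/-- **The thin ring, tube by tube** (`1 ≤ r / s`, `g < 12n - 4`). [folklore] -/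
theorem getElem?_thinRing {r e s : ℕ} (hr : 1 ≤ r / s) {g : ℕ} (hg : g < 12 * (r / s) - 4) :
    (thinRing r e s)[g]? = some (ringTube r e s g) := by
  have hH := length_thinHalfRing (e := e) hr
  unfold thinRing ringTube
  by_cases h : g < 6 * (r / s) - 2
  · rw [if_pos h, List.getElem?_append_left (by omega), getElem?_thinHalfRing hr h]
  · rw [if_neg h, List.getElem?_append_right (by omega), List.getElem?_map, hH, getElem?_thinHalfRing hr (by omega)]
    rfl

/-- A tube of the thin ring is `ringTube g` for some index `g < 12n - 4` (`1 ≤ r / s`). [folklore] -/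
theorem exists_eq_ringTube_of_mem {r e s : ℕ} (hr : 1 ≤ r / s) {T : Tube} (hT : T ∈ thinRing r e s) :
    ∃ g, g < 12 * (r / s) - 4 ∧ T = ringTube r e s g := by
  obtain ⟨g, hg⟩ := List.mem_iff_getElem?.1 hT
  have hgl : g < (thinRing r e s).length := (List.getElem?_eq_some_iff.1 hg).1
  rw [length_thinRing hr] at hgl
  rw [getElem?_thinRing hr hgl] at hg
  exact ⟨g, hgl, (Option.some.inj hg).symm⟩

/-- The side of a tube is `< 6`. [folklore] -/
theorem ringSide_lt (r s g : ℕ) : ringSide r s g < 6 := by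
  unfold ringSide; split_ifs <;> omega

/-- The lateral index of a tube is `< n` (`1 ≤ r / s`). [folklore] -/
theorem ringLat_lt {r s g : ℕ} (hr : 1 ≤ r / s) : ringLat r s g < r / s := by
  unfold ringLat; split_ifs <;> omega

/-! ### Where the tubes are -/

/-- The reflection of a sector is the opposite sector: `-v ∈ sectorNear i λ ↔ v ∈ sectorNear (i + 3) λ` (`i < 3`). [folklore] -/
theorem neg_mem_sectorNear_iff {i : ℕ} (hi : i < 3) {lam : ℤ} {v : Site 2} : -v ∈ sectorNear i lam ↔ v ∈ sectorNear (i + 3) lam := by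
  interval_cases i <;> (simp only [sectorNear, Set.mem_setOf_eq, Pi.neg_apply]; omega)

/-- The lateral coordinate of the reflection: `lat i (-v) = lat (i + 3) v` (`i < 3`). [folklore] -/
theorem lat_neg {i : ℕ} (hi : i < 3) (v : Site 2) : lat i (-v) = lat (i + 3) v := by
  interval_cases i <;> simp only [lat, Pi.neg_apply, neg_neg]

/-- Side `0` block: pieces and connectors `V_j, C_j` (`(j+1) s ≤ r`) lie in `sectorNear 0 (-2e)` with
lateral coordinate `x₁ ∈ [-r + js - e, -r + (j+1)s + e]`. [folklore] -/
theorem vblock_bounds {r e s j : ℕ} (hj : (j + 1) * s ≤ r) {T : Tube}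
    (hT : T = vPiece r (-(r : ℤ)) e s j ∨ T = vConn r (-(r : ℤ)) e s j) {v : Site 2} (hv : v ∈ T.box) :
    v ∈ sectorNear 0 (-(2 * (e : ℤ))) ∧ -(r : ℤ) + j * s - e ≤ lat 0 v ∧ lat 0 v ≤ -(r : ℤ) + (j + 1) * s + e := by
  have hj' : (j : ℤ) * s + s ≤ r := by have := (Nat.cast_le (α := ℤ)).2 hj; push_cast at this; linarith
  have hj0 : (0 : ℤ) ≤ (j : ℤ) * s := by positivity
  simp only [sectorNear, lat, Set.mem_setOf_eq]
  rcases hT with rfl | rfl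
  · rw [Tube.mem_box] at hv; simp only [vPiece, Nat.cast_add, Nat.cast_mul, Nat.cast_ofNat] at hv
    refine ⟨⟨by linarith, by linarith⟩, by linarith, by linarith⟩
  · rw [Tube.mem_box] at hv; simp only [vConn, Nat.cast_mul, Nat.cast_ofNat] at hv
    refine ⟨⟨by linarith, by linarith⟩, by linarith, by linarith⟩

/-- Side `1` block: steps `H_j, V_j` (`(j+1) s ≤ r`) lie in `sectorNear 1 (-2e)` with lateral
coordinate `-x₀ ∈ [-r + js - e, -r + (j+1)s + e]`. [folklore] -/
theorem sblock_bounds {r e s j : ℕ} (hj : (j + 1) * s ≤ r) {T : Tube} (hT : T = stairH r e s j ∨ T = stairV r e s j) {v : Site 2}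
    (hv : v ∈ T.box) :
    v ∈ sectorNear 1 (-(2 * (e : ℤ))) ∧ -(r : ℤ) + j * s - e ≤ lat 1 v ∧ lat 1 v ≤ -(r : ℤ) + (j + 1) * s + e := by
  have hj' : (j : ℤ) * s + s ≤ r := by have := (Nat.cast_le (α := ℤ)).2 hj; push_cast at this; linarith
  have hj0 : (0 : ℤ) ≤ (j : ℤ) * s := by positivity
  simp only [sectorNear, lat, Set.mem_setOf_eq]
  rcases hT with rfl | rfl
  · rw [Tube.mem_box] at hv; simp only [stairH, Nat.cast_add, Nat.cast_mul, Nat.cast_ofNat] at hv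
    refine ⟨⟨by linarith, by linarith⟩, by linarith, by linarith⟩
  · rw [Tube.mem_box] at hv; simp only [stairV, Nat.cast_add, Nat.cast_mul, Nat.cast_ofNat] at hv
    refine ⟨⟨by linarith, by linarith⟩, by linarith, by linarith⟩

/-- Side `2` block: pieces and connectors `H_j, D_j` of the side `x₁ = r` (`(j+1) s ≤ r = n s`) lie in
`sectorNear 2 (-2e)` with lateral coordinate `x₀ ∈ [-r + (n-1-j)s - e, -r + (n-j)s + e]`. [folklore] -/
theorem hblock_bounds {r e s j n : ℕ} (hn : n * s = r) (hj : j + 1 ≤ n) {T : Tube}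
    (hT : T = hPiece 0 r e s j ∨ T = hConn 0 r e s j) {v : Site 2} (hv : v ∈ T.box) :
    v ∈ sectorNear 2 (-(2 * (e : ℤ))) ∧ -(r : ℤ) + ((n - 1 - j : ℕ) : ℤ) * s - e ≤ lat 2 v ∧
      lat 2 v ≤ -(r : ℤ) + (((n - 1 - j : ℕ) : ℤ) + 1) * s + e := by
  have hcast : ((n - 1 - j : ℕ) : ℤ) = n - 1 - j := by omega
  have hn' : (n : ℤ) * s = r := by exact_mod_cast hn
  have hj0 : (0 : ℤ) ≤ (j : ℤ) * s := by positivity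
  have hjs : (j : ℤ) * s + s ≤ n * s := by
    have := Nat.mul_le_mul_right s hj; have := (Nat.cast_le (α := ℤ)).2 this; push_cast at this; linarith
  rw [hcast]
  simp only [sectorNear, lat, Set.mem_setOf_eq]
  rcases hT with rfl | rfl
  · rw [Tube.mem_box] at hv; simp only [hPiece, Nat.cast_add, Nat.cast_mul, Nat.cast_ofNat] at hv
    refine ⟨⟨by linarith, by linarith⟩, by nlinarith, by nlinarith⟩
  · rw [Tube.mem_box] at hv; simp only [hConn, Nat.cast_mul, Nat.cast_ofNat] at hv
    refine ⟨⟨by linarith, by linarith⟩, by nlinarith, by nlinarith⟩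

/-- **Where the tubes of the half ring are**: the `ℓ`-th tube lies in the sector of its side with
overshoot `2e`, with lateral coordinate in `[-r + ι s - e, -r + (ι+1) s + e]` (`ι` its lateral
index) (`1 ≤ r / s`, `s ∣ r`, `ℓ < 6n - 2`). [folklore] -/
theorem halfTube_bounds {r e s : ℕ} (hr : 1 ≤ r / s) (hsr : s ∣ r) {ℓ : ℕ} (hℓ : ℓ < 6 * (r / s) - 2) {v : Site 2}
    (hv : v ∈ (halfTube r e s ℓ).box) :
    v ∈ sectorNear (ringSide r s ℓ) (-(2 * (e : ℤ))) ∧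
      -(r : ℤ) + ringLat r s ℓ * s - e ≤ lat (ringSide r s ℓ) v ∧ lat (ringSide r s ℓ) v ≤ -(r : ℤ) + (ringLat r s ℓ + 1) * s + e := by
  have hn : (r / s) * s = r := Nat.div_mul_cancel hsr
  have hside : ringSide r s ℓ = (if ℓ < 2 * (r / s) - 1 then 0 else if ℓ < 4 * (r / s) - 1 then 1 else 2) := by
    unfold ringSide; rw [if_pos hℓ]
  have hlat : ringLat r s ℓ = (if ℓ < 2 * (r / s) - 1 then ℓ / 2 else if ℓ < 4 * (r / s) - 1 then (ℓ - (2 * (r / s) - 1)) / 2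
      else r / s - 1 - (ℓ - (4 * (r / s) - 1)) / 2) := by
    unfold ringLat; rw [if_pos hℓ]
  unfold halfTube at hv
  by_cases h1 : ℓ < 2 * (r / s) - 1
  · rw [if_pos h1] at hv hside hlat
    rw [hside, hlat]
    have hj : (ℓ / 2 + 1) * s ≤ r := (Nat.mul_le_mul_right s (by omega : ℓ / 2 + 1 ≤ r / s)).trans hn.le
    refine vblock_bounds hj ?_ hv
    split_ifs with h2
    · exact Or.inl rfl
    · exact Or.inr rfl
  · rw [if_neg h1] at hv hside hlat
    by_cases h3 : ℓ < 4 * (r / s) - 1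
    · rw [if_pos h3] at hv hside hlat
      rw [hside, hlat]
      have hj : ((ℓ - (2 * (r / s) - 1)) / 2 + 1) * s ≤ r :=
        (Nat.mul_le_mul_right s (by omega : (ℓ - (2 * (r / s) - 1)) / 2 + 1 ≤ r / s)).trans hn.le
      refine sblock_bounds hj ?_ hv
      split_ifs with h2
      · exact Or.inl rfl
      · exact Or.inr rfl
    · rw [if_neg h3] at hv hside hlat
      rw [hside, hlat]
      have hj : (ℓ - (4 * (r / s) - 1)) / 2 + 1 ≤ r / s := by omega
      have key := hblock_bounds (e := e) hn hj ?_ hv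
      · exact key
      · split_ifs with h2
        · exact Or.inl rfl
        · exact Or.inr rfl

/-- **Where the tubes of the thin ring are**: the `g`-th tube lies in the sector of its side
`ringSide g` with overshoot `2e`, its lateral coordinate in that side's frame lies in
`[-r + ι s - e, -r + (ι+1) s + e]` (`ι = ringLat g`), and its norm in `[r - s - 2e, r + 2e]`
(`1 ≤ r / s`, `s ∣ r`, `2e ≤ r`, `g < 12n - 4`). [folklore] -/
theorem ringTube_bounds {r e s : ℕ} (hr : 1 ≤ r / s) (hsr : s ∣ r) (he : 2 * e ≤ r) {g : ℕ} (hg : g < 12 * (r / s) - 4)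
    {v : Site 2} (hv : v ∈ (ringTube r e s g).box) :
    v ∈ sectorNear (ringSide r s g) (-(2 * (e : ℤ))) ∧
      -(r : ℤ) + ringLat r s g * s - e ≤ lat (ringSide r s g) v ∧ lat (ringSide r s g) v ≤ -(r : ℤ) + (ringLat r s g + 1) * s + e ∧
      (r : ℤ) - s - 2 * e ≤ triNorm v ∧ triNorm v ≤ (r : ℤ) + 2 * e := by
  have hmem : ringTube r e s g ∈ thinRing r e s := by
    have h := getElem?_thinRing (e := e) hr hg
    exact List.mem_of_getElem? h
  have hnorm := triNorm_mem_of_mem_thinRing he hmem hv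
  suffices key : v ∈ sectorNear (ringSide r s g) (-(2 * (e : ℤ))) ∧
      -(r : ℤ) + ringLat r s g * s - e ≤ lat (ringSide r s g) v ∧ lat (ringSide r s g) v ≤ -(r : ℤ) + (ringLat r s g + 1) * s + e from
    ⟨key.1, key.2.1, key.2.2, hnorm.1, hnorm.2⟩
  unfold ringTube at hv
  by_cases h : g < 6 * (r / s) - 2
  · rw [if_pos h] at hv
    exact halfTube_bounds hr hsr h hv
  · rw [if_neg h] at hv
    have hv' := mem_box_neg.1 hv
    have hℓ : g - (6 * (r / s) - 2) < 6 * (r / s) - 2 := by omega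
    have hb := halfTube_bounds hr hsr hℓ hv'
    have hs3 : ringSide r s (g - (6 * (r / s) - 2)) < 3 := by
      unfold ringSide; rw [if_pos hℓ]; split_ifs <;> omega
    have hside : ringSide r s g = ringSide r s (g - (6 * (r / s) - 2)) + 3 := by
      unfold ringSide; rw [if_neg h, if_pos hℓ]; split_ifs <;> rfl
    have hlat : ringLat r s g = ringLat r s (g - (6 * (r / s) - 2)) := by
      unfold ringLat; rw [if_neg h, if_pos hℓ]
    rw [hside, hlat, ← neg_mem_sectorNear_iff hs3, ← lat_neg hs3]
    exact hb

/-! ### Windows and their complements -/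

/-- **The tubes of the complement of a window**: a tube of `arc L (hi+1) (|L| - (hi - lo + 1))`
is `L[g]` for some index `g` outside `[lo, hi]` (`lo ≤ hi < |L|`). [folklore] -/
theorem mem_arc_compl {L : List Tube} {lo hi : ℕ} (hlo : lo ≤ hi) (hhi : hi < L.length) {T : Tube}
    (hT : T ∈ arc L (hi + 1) (L.length - (hi - lo + 1))) : ∃ g, g < L.length ∧ (g < lo ∨ hi < g) ∧ L[g]? = some T := by
  obtain ⟨idx, hidx⟩ := List.mem_iff_getElem?.1 hT
  have hil : idx < (arc L (hi + 1) (L.length - (hi - lo + 1))).length := (List.getElem?_eq_some_iff.1 hidx).1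
  rw [length_arc (by omega)] at hil
  rw [getElem?_arc (by omega) (by omega)] at hidx
  refine ⟨(idx + (hi + 1)) % L.length, Nat.mod_lt _ (by omega), ?_, hidx⟩
  by_cases h : idx + (hi + 1) < L.length
  · rw [Nat.mod_eq_of_lt h]; right; omega
  · rw [Nat.mod_eq_sub_mod (not_lt.1 h), Nat.mod_eq_of_lt (by omega)]; left; omega

/-- **The complement of a window contains every tube outside the window** (`lo ≤ hi < |L|`,
`g < |L|`, `g ∉ [lo, hi]`). [folklore] -/
theorem getElem_mem_arc_compl {L : List Tube} {lo hi g : ℕ} (hlo : lo ≤ hi) (hhi : hi < L.length) (hg : g < L.length)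
    (hout : g < lo ∨ hi < g) : L[g] ∈ arc L (hi + 1) (L.length - (hi - lo + 1)) := by
  -- the position of `g` in the arc
  obtain ⟨idx, hidx, hmod⟩ : ∃ idx, idx < L.length - (hi - lo + 1) ∧ (idx + (hi + 1)) % L.length = g := by
    rcases hout with hout | hout
    · refine ⟨g + L.length - (hi + 1), by omega, ?_⟩
      rw [show g + L.length - (hi + 1) + (hi + 1) = g + L.length by omega, Nat.add_mod_right, Nat.mod_eq_of_lt hg]
    · exact ⟨g - (hi + 1), by omega, by rw [Nat.sub_add_cancel (by omega), Nat.mod_eq_of_lt hg]⟩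
  have h := getElem_mem_arc (L := L) (a := hi + 1) hidx (by omega)
  simp only [hmod] at h
  exact h

end Literature.Probability.Percolation
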